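import Literature.NumberTheory.EllipticCurves.Rank1Residual.X11RankOneCertificates.Schema
import HarnessLib

/-!
# Leaves X9 (`5Ns`/`5S4`/`7Ns`) and X10b (`3Ns`/`3Nn`) — per-pair certificate records: the record SCHEMA and its in-kernel recheck

HONEST FRAMING (cell `bsd-print-x9`, D-0131 (2) print tier; partition leaves `ClassX9` and
`ClassX10 ∧ ¬Surj` of `Rank1Residual/Partition/CornersAll.lean`): a record is DATA about one (Cremona
curve, prime) pair of the two leaves; no named fact; nothing is asserted about elliptic curves. The
leaves stay what they are (`BSDpOnClassX9`, `BSDpOnClassX10b` are `@[conjecture]` nodes; class-wide they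
need Greenberg's `μ = 0` and, in rank `1`, Schneider's non-degeneracy — route `SmallImageMuTransfer`,
items 19629/19630/19631). The records carry, in ONE format, the FINITE per-pair certificate data that
per-pair discharges of those class statements consume — the two-engine analytic `μ = 0` / `λ`
certificate, the descent-side BSD invariants, an image certificate — rechecked by the kernel wherever
the recheck is elementary arithmetic. Our own bookkeeping, hence `Summits/` (namespace
`Summit.BirchSwinnertonDyer.Rank1Residual.X9.PrintCert`; the X10b slices live here too). Companions:
`X9/PrintCertClaim.lean` (what a record CLAIMS about its curve in the tree's vocabulary — a `Prop` taken
as a hypothesis, D-0014 style — and what a passing recheck DISCHARGES in the kernel: good ordinary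
reduction at `p`, irreducibility of `E[p]`, via the cell `b2b-bsdres` toolkit `IntModel`) and the display
files `X9/PrintCertRecords*.lean` (one list per image type and rank, `Certified […]` by `decide`). FORMAT
after `Literature/…/X11RankOneCertificates/Schema.lean`, whose kernel-evaluable arithmetic (`natVal`,
`isPrimeBelow504100`, `legendreSym`, `c4Of`/`c6Of`/`discOf`, `countPoints`/`apNaive`, …) is REUSED.

## Fields and rechecks (`Record.check`, decidable) — curve `label`, minimal model `ainvs`, prime `p`

* `bad = [(q, f_q, v_q(Δ), c_q)]` (increasing): RECHECKED `q` prime, `conductor = ∏ q^{f_q}`,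
  `|Δ(ainvs)| = ∏ q^{v_q(Δ)}` (Δ RECOMPUTED ⇒ `p ∤ Δ`: GOOD at `p`), `tamagawa = ∏ c_q`, Tate's
  `c_q ∈ {v_q(Δ), 1, 2}` (`2 ⇒ 2 ∣ v_q(Δ)`) at multiplicative `q`, `c_q ≤ 4` at additive `q`,
  `f_q ≤ 2` (`q ≥ 5`), `f_2 ≤ 8`, `f_3 ≤ 5`; `kodaira` = documentation.
* `ap`, `nP = p + 1 − a_p` RECOMPUTED by point counting; `p ∤ a_p` (ORDINARY); `p = imageType.prime`.
* `irrWitness = (ℓ, a_ℓ)`: good odd `ℓ ≠ p`, `ℓ < 200`, `a_ℓ` RECOMPUTED, `X² − a_ℓX + ℓ` root-free mod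
  `p` ⇒ `E[p]` IRREDUCIBLE (Mazur 1978 Prop. 6.3 (1), as in `IntModel`); `isogDegrees` (Cremona
  `allisog`): `1` listed, `p ∤ d`; `p ∤ torsion`. Non-CM: `c₄³ ≠ j_CM · Δ` for the 13 CM `j`.
* `imageType ∈ {3Ns, 3Nn, 5Ns, 5S4, 7Ns}` + IMAGE CERTIFICATE `imageCert = some (u, v)`: `t = u/v ∈ X_G(ℚ)`
  with `j(ainvs) = J_G(t)` EXACTLY for Zywina's map (arXiv:1508.07660 §1.2 `J₂`/`J₄`, §1.3 `J₄`/`J₉`,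
  §1.4 `J₂`), RECHECKED as the integer identity `c₄³·B(u,v) = Δ·A(u,v)`. By Zywina Thm. 1.2/1.4/1.5 (ii)
  (= Sutherland–Zywina 2017 §1 p. 3, `j ∉ {0,1728}`) the image is then conjugate into the proper
  subgroup `G` — print, not kernel: `¬Surj` stays a CLAIM. `none` allowed; `image`/`galrep` = Cremona's codes.
* `rank ≤ 1` (analytic = MW), `rootNumber = (−1)^rank`, `torsion`, `tamagawa`, `shaAn > 0`; rank `0`:
  `x0 = L(E,1)/Ω_E = (num, den)` with `num·torsion² = shaAn·tamagawa·den` RECHECKED; rank `1`: `(0,1)`.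
* leaf clauses from `bad` (verbatim `Rank1Residual.ClassX9` / `ClassX10`): `p ≥ 5`: `rank = 1 → ¬sst`;
  `p = 3`: `(rank = 0 ∧ ¬ram(3)) ∨ (rank = 1 ∧ ¬sst)`, `ram(3) ⇔ ∃ q ≠ 3, f_q = 1, 3 ∤ v_q(Δ)`.
* TWO-ENGINE IWASAWA CERTIFICATE `muAn = 0`, `lambdaAn`, `lpLevel`, `engines`: `μ`/`λ` of the
  Néron-normalised `ϖ·L_p(f, α, T)` modulo `ω_n` (X9: engines B/C of `b2b-bsdres-x9` gen 9, `MU-ALL.tsv`,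
  790/790; X10b: `MUCERT3`, three engines). RECHECKED for coherence: `λ ≡ rank (mod 2)` (functional
  equation); rank `0`: `λ = 0 ↔ (p ∤ num·den(x0) ∧ a_p ≢ 1)` (`L_p(0) = (1 − α⁻¹)²·L(E,1)/Ω_E` up to the
  period unit) — a cross-check of the engines' `λ` against Cremona's `L/Ω`. VALUES are CLAIMS.
* rank-`1` extras: `heegner = [(D, m, v_p(m))]` (Heegner index of record; RECHECKED `D < 0`,
  `D ≡ 0,1 (4)`, Heegner hypothesis at every bad `q`, `p ∤ D`, `v = v_p(m)`), `schneider = (v_p Reg_p, digits)`,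
  `partners`; `engines`/`notes` = provenance strings.
NOT checked (CLAIMS, `PrintCertClaim.lean`): global minimality, conductor, analytic rank, `#Ш_an` (r1),
non-surjectivity / image type beyond the `j`-identity, the values `μ_an`, `λ_an`.

Design: plain computable data, naive arithmetic, `decide` in the kernel (no `native_decide`, no axioms).
References: [Zywina2015] §§1.2–1.4; [SutherlandZywina2017] §1; [Mazur1978] Prop. 6.3; [SilvermanAEC2009]
VII.5.1, App. C §15, App. A §3; [MazurTateTeitelbaum1986Invent] §I.14; [GreenbergLNM1716] Conj. 1.11;
[GreenbergVatsal2000] (1)–(2), Prop. 3.7; [Cremona2006]; cell files `b2b-bsdres-x9/g9/mu/MU-ALL.tsv`,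
`class-closure/N2/MUCERT3-x10g36.tsv`, `b2b-bsdres-x9/g9/fold_g9FINAL.pairs.tsv`.
-/

namespace Summit.BirchSwinnertonDyer.Rank1Residual.X9.PrintCert

open Literature.NumberTheory.EllipticCurves.Rank1Residual.X11RankOneCertificates (natVal
  isPrimeBelow504100 strictlyIncreasing legendreSym c4Of discOf apNaive)

/-- The five mod-`p` image types met on the two leaves (Sutherland's labels): at `p = 3` the
normaliser of a split / non-split Cartan subgroup (`3Ns`, `3Nn`: leaf X10b), at `p = 5` the
normaliser of a split Cartan subgroup or the exceptional group with projective image `𝔖₄` (`5Ns`,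
`5S4`), at `p = 7` the normaliser of a split Cartan subgroup (`7Ns`) — leaf X9 (a non-split Cartan
normaliser never meets a good ORDINARY `p ≥ 5`, `ClassX9.not_le_normalizer_unitGroup`; `p ∈ {5,7}` by
`ClassX9.eq_five_or_eq_seven`). [folklore] -/
inductive ImageType where
  /-- `3Ns`: image in the normaliser of a split Cartan subgroup of `GL₂(𝔽₃)` (Zywina §1.2, `G₂`). -/
  | ns3
  /-- `3Nn`: image in the normaliser of a non-split Cartan subgroup of `GL₂(𝔽₃)` (Zywina §1.2, `G₄`). -/
  | nn3
  /-- `5Ns`: image in the normaliser of a split Cartan subgroup of `GL₂(𝔽₅)` (Zywina §1.3, `G₄`). -/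
  | ns5
  /-- `5S4`: image the exceptional maximal subgroup of `GL₂(𝔽₅)` containing `N_s(5)`, projectively
  `𝔖₄` (Zywina §1.3, `G₉`). -/
  | s4
  /-- `7Ns`: image in the normaliser of a split Cartan subgroup of `GL₂(𝔽₇)` (Zywina §1.4, `G₂`). -/
  | ns7
  deriving DecidableEq, Repr

/-- The prime of an image type (`3`, `3`, `5`, `5`, `7`). [folklore] -/
def ImageType.prime : ImageType → ℕ | .ns3 => 3 | .nn3 => 3 | .ns5 => 5 | .s4 => 5 | .ns7 => 7

/-- Numerator `A(u,v)` of Zywina's `j`-map `J_G(u/v) = A(u,v)/B(u,v)` of the genus-`0` modular curve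
`X_G`, homogenised with integer coefficients: `3Ns`: `27(t+1)³(t−3)³/t³`; `3Nn`: `t³`; `5Ns`:
`(t+5)³(t²−5)³(t²+5t+10)³/(t²+5t+5)⁵`; `5S4`: `t³(t²+5t+40)`; `7Ns`:
`t(t+1)³(t²−5t+1)³(t²−5t+8)³(t⁴−5t³+8t²−7t+7)³/(t³−4t²+3t+1)⁷` (`t = u/v`).
[cite: Zywina2015, §1.2 (J₂, J₄), §1.3 (J₄, J₉), §1.4 (J₂) (arXiv:1508.07660 pp. 3–5)] -/
def jMapNum : ImageType → ℤ → ℤ → ℤ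
  | .ns3, u, v => 27 * (u + v) ^ 3 * (u - 3 * v) ^ 3
  | .nn3, u, _ => u ^ 3
  | .ns5, u, v => (u + 5 * v) ^ 3 * (u ^ 2 - 5 * v ^ 2) ^ 3 * (u ^ 2 + 5 * u * v + 10 * v ^ 2) ^ 3
  | .s4, u, v => u ^ 3 * (u ^ 2 + 5 * u * v + 40 * v ^ 2)
  | .ns7, u, v => u * (u + v) ^ 3 * (u ^ 2 - 5 * u * v + v ^ 2) ^ 3 * (u ^ 2 - 5 * u * v + 8 * v ^ 2) ^ 3 *
      (u ^ 4 - 5 * u ^ 3 * v + 8 * u ^ 2 * v ^ 2 - 7 * u * v ^ 3 + 7 * v ^ 4) ^ 3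

/-- Denominator `B(u,v)` of the homogenised `j`-map (see `jMapNum`): `3Ns`: `u³v³`; `3Nn`: `v³`;
`5Ns`: `(u²+5uv+5v²)⁵ v⁵`; `5S4`: `v⁵`; `7Ns`: `(u³−4u²v+3uv²+v³)⁷ v⁷`.
[cite: Zywina2015, §1.2 (J₂, J₄), §1.3 (J₄, J₉), §1.4 (J₂) (arXiv:1508.07660 pp. 3–5)] -/
def jMapDen : ImageType → ℤ → ℤ → ℤ
  | .ns3, u, v => u ^ 3 * v ^ 3
  | .nn3, _, v => v ^ 3
  | .ns5, u, v => (u ^ 2 + 5 * u * v + 5 * v ^ 2) ^ 5 * v ^ 5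
  | .s4, _, v => v ^ 5
  | .ns7, u, v => (u ^ 3 - 4 * u ^ 2 * v + 3 * u * v ^ 2 + v ^ 3) ^ 7 * v ^ 7

/-- The thirteen `j`-invariants of CM elliptic curves over `ℚ` (all integers; the tree's `cmJInvariants`
as a list of integers). [cite: SilvermanAEC2009, App. A §3 (table of CM j-invariants)] -/
def cmJList : List ℤ :=
  [0, 1728, -3375, 8000, -32768, 54000, 287496, -884736, -12288000, 16581375, -884736000,
    -147197952000, -262537412640768000]

/-- One certificate record of the leaves X9 / X10b: the DATA of one (Cremona curve, prime) pair, see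
the module docstring for the meaning of each field. A record asserts nothing by itself; `Record.check`
is its decidable recheck. [folklore] -/
structure Record where
  /-- Cremona label of the curve (e.g. `"2268b1"`). -/
  label : String
  /-- a-invariants `[a₁, a₂, a₃, a₄, a₆]` of the reduced global minimal model. -/
  ainvs : List ℤ
  /-- the conductor `N`. -/
  conductor : ℕ
  /-- the prime `p ∈ {3, 5, 7}` (good ordinary, `E[p]` irreducible, `ρ̄_{E,p}` not surjective). -/
  p : ℕ
  /-- the image type at `p` (census). -/
  imageType : ImageType
  /-- Cremona's Sutherland code at `p` (e.g. `"5S4"`, `"5Ns"`, `"3Ns"`, `"3Nn"`, `"7Ns"`); documentation. -/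
  image : String
  /-- all Sutherland codes of the curve (Cremona `galrep` line); documentation. -/
  galrep : List String
  /-- image certificate `t = u/v` (`v ≠ 0`) with `j(ainvs) = J_{imageType}(u/v)` exactly, or `none`. -/
  imageCert : Option (ℤ × ℤ)
  /-- `(q, f_q, v_q(Δ_min), c_q)` for every bad prime `q`, increasing in `q`. -/
  bad : List (ℕ × ℕ × ℕ × ℕ)
  /-- Kodaira symbols at the bad primes, in the order of `bad`; documentation. -/
  kodaira : List String
  /-- `a_p` (recomputed by point counting in the recheck). -/
  ap : ℤ
  /-- `#Ẽ(𝔽_p) = p + 1 − a_p`. -/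
  nP : ℕ
  /-- irreducibility witness `(ℓ, a_ℓ)`: good odd `ℓ ≠ p`, `X² − a_ℓX + ℓ` root-free mod `p`. -/
  irrWitness : ℕ × ℤ
  /-- degrees of the rational isogenies from the curve (Cremona `allisog` row), `1` included. -/
  isogDegrees : List ℕ
  /-- analytic rank = Mordell–Weil rank (`0` or `1`). -/
  rank : ℕ
  /-- global root number. -/
  rootNumber : ℤ
  /-- `#E(ℚ)_tors`. -/
  torsion : ℕ
  /-- the Tamagawa product `∏_q c_q`. -/
  tamagawa : ℕ
  /-- the analytic order of `Ш` (exact for rank `0`; the engines' integer for rank `1`). -/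
  shaAn : ℕ
  /-- `L(E,1)/Ω_E` as `(numerator, denominator)` for rank `0`; `(0, 1)` for rank `1`. -/
  x0 : ℤ × ℕ
  /-- certified analytic `μ`-invariant of `ϖ·L_p(f, α, T)` (two engines): `0`. -/
  muAn : ℕ
  /-- certified analytic `λ`-invariant (index of the first unit coefficient), two engines. -/
  lambdaAn : ℕ
  /-- the layer `n` (`L_p` modulo `ω_n = (1+T)^{p^n} − 1`) at which the engines certified `μ`, `λ`. -/
  lpLevel : ℕ
  /-- rank `1`: Heegner data `(D, m, v_p(m))` of record (index `m = [E(K) : ℤ y_K]`), possibly `[]`. -/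
  heegner : List (ℤ × ℕ × ℕ)
  /-- rank `1`: `(v_p(Reg_p), digits)` of the normalised cyclotomic `p`-adic regulator, or `none`. -/
  schneider : Option (ℤ × ℕ)
  /-- labels of `p`-congruent partner curves of record; documentation. -/
  partners : List String
  /-- provenance strings (engines, kit jobs, source tables); documentation. -/
  engines : List String
  /-- free-text notes (e.g. the lane's route of record for the pair); documentation. -/
  notes : String
  deriving DecidableEq

/-! ### The recheck -/
namespace Record

variable (r : Record)

/-- `f_q` (conductor exponent) as recorded in `bad` (`0` if `q` is not listed). [folklore] -/
def fq (q : ℕ) : ℕ := ((r.bad.find? fun t => t.1 == q).map fun t => t.2.1).getD 0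
/-- `v_q(Δ)` as recorded in `bad` (`0` if `q` is not listed). [folklore] -/
def vD (q : ℕ) : ℕ := ((r.bad.find? fun t => t.1 == q).map fun t => t.2.2.1).getD 0

/-- `p` is anomalous for the record: `a_p ≡ 1 (mod p)`. [folklore] -/
def anomalous : Bool := decide ((r.ap - 1) % (r.p : ℤ) = 0)

/-- The curve of the record is semistable according to `bad`: every conductor exponent is `1`. [folklore] -/
def semistable : Bool := r.bad.all fun t => t.2.1 == 1

/-- (ram) at `p` according to `bad`: some multiplicative `q ≠ p` (`f_q = 1`) has `p ∤ v_q(Δ)`.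
[cite: SkinnerUrban2014, Thm. 2 (p. 3), second bullet] -/
def ram : Bool := r.bad.any fun t => decide (t.1 ≠ r.p) && (t.2.1 == 1) && decide (t.2.2.1 % r.p ≠ 0)

/-- Shape and support: five a-invariants; bad primes prime, increasing; `N = ∏ q^{f_q}`;
`|Δ(ainvs)| = ∏ q^{v_q(Δ)}` (RECOMPUTED discriminant, `≠ 0`), `q^{v_q(Δ)} ‖ Δ` exactly; `tamagawa = ∏ c_q > 0`;
conductor-exponent bounds `f_q ≤ 2` (`q ≥ 5`), `f_2 ≤ 8`, `f_3 ≤ 5`; the reduction type read off the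
minimal model, `f_q = 1 ↔ q ∤ c₄` (multiplicative iff `q ∣ Δ`, `q ∤ c₄`; additive iff `q ∣ Δ`, `q ∣ c₄`);
at a multiplicative `q`: `c_q = v_q(Δ)` (split) or `c_q ∈ {1, 2}` with `c_q = 2 ⇒ 2 ∣ v_q(Δ)` (non-split);
at an additive `q`: `1 ≤ c_q ≤ 4`. [cite: SilvermanAEC2009, Prop. VII.5.1, App. C §15 Table 15.1] -/
def passSupport : Bool :=
  (r.ainvs.length == 5) &&
  r.bad.all (fun t => isPrimeBelow504100 t.1 && decide (0 < t.2.1) && decide (0 < t.2.2.1) &&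
    decide (0 < t.2.2.2) &&
    (decide (5 ≤ t.1 ∧ t.2.1 ≤ 2) || decide (t.1 = 2 ∧ t.2.1 ≤ 8) || decide (t.1 = 3 ∧ t.2.1 ≤ 5)) &&
    decide (discOf r.ainvs % (t.1 : ℤ) ^ t.2.2.1 = 0) && decide (discOf r.ainvs % (t.1 : ℤ) ^ (t.2.2.1 + 1) ≠ 0) &&
    ((t.2.1 == 1) == decide (c4Of r.ainvs % (t.1 : ℤ) ≠ 0)) &&
    (if t.2.1 == 1 then
      (t.2.2.2 == t.2.2.1) || (t.2.2.2 == 1) || ((t.2.2.2 == 2) && (t.2.2.1 % 2 == 0))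
     else decide (t.2.2.2 ≤ 4))) &&
  strictlyIncreasing (r.bad.map (·.1)) &&
  ((r.bad.map fun t => t.1 ^ t.2.1).prod == r.conductor) &&
  (((r.bad.map fun t => t.1 ^ t.2.2.1).prod : ℕ) == (discOf r.ainvs).natAbs) &&
  decide (discOf r.ainvs ≠ 0) &&
  ((r.bad.map fun t => t.2.2.2).prod == r.tamagawa) && decide (0 < r.tamagawa)

/-- Reduction at `p`: `p = imageType.prime ∈ {3,5,7}`; `p` is NOT a bad prime (good reduction:
`p ∤ Δ_min`, the discriminant being supported on `bad` by `passSupport`); `a_p` RECOMPUTED by point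
counting equals `ap`, `nP = p + 1 − a_p`, and `p ∤ a_p` (ORDINARY). [cite: SilvermanAEC2009, Prop. VII.5.1] -/
def passReduction : Bool :=
  (r.p == r.imageType.prime) && (r.fq r.p == 0) && decide (discOf r.ainvs % (r.p : ℤ) ≠ 0) &&
  (apNaive r.ainvs r.p == r.ap) && decide (((r.nP : ℤ)) = (r.p : ℤ) + 1 - r.ap) &&
  decide (r.ap % (r.p : ℤ) ≠ 0)

/-- Irreducibility witness: `ℓ` an odd prime `< 200`, `ℓ ≠ p`, `ℓ ∤ N·Δ`, `a_ℓ` RECOMPUTED by point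
counting, and `X² − a_ℓ X + ℓ` has no root mod `p`; plus `1 ∈ isogDegrees`, `p ∤ d` for every listed
isogeny degree, and `p ∤ #E(ℚ)_tors`. [cite: Mazur1978, §6 Prop. 6.3 (1) (p. 153)] -/
def passIrr : Bool :=
  let l := r.irrWitness.1
  let a := r.irrWitness.2
  decide (3 ≤ l) && decide (l < 200) && isPrimeBelow504100 l && decide (l ≠ r.p) &&
  decide (r.conductor % l ≠ 0) && decide (discOf r.ainvs % (l : ℤ) ≠ 0) && (apNaive r.ainvs l == a) &&
  (List.range r.p).all (fun x => decide ((((x : ℤ) ^ 2 - a * x + l) % (r.p : ℤ)) ≠ 0)) &&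
  r.isogDegrees.contains 1 && r.isogDegrees.all (fun d => decide (d % r.p ≠ 0)) &&
  decide (r.torsion % r.p ≠ 0)

/-- Non-CM: `j(ainvs) = c₄³/Δ` is none of the thirteen CM `j`-invariants (`c₄³ ≠ j·Δ`).
[cite: SilvermanAEC2009, App. A §3 (table of CM j-invariants)] -/
def passNonCM : Bool :=
  cmJList.all fun jcm => decide ((c4Of r.ainvs) ^ 3 ≠ jcm * discOf r.ainvs)

/-- Image certificate: if `imageCert = some (u, v)` then `v ≠ 0`, `B(u,v) ≠ 0` and
`c₄(ainvs)³ · B(u,v) = Δ(ainvs) · A(u,v)`, i.e. `j(E) = J_G(u/v)` exactly for Zywina's map of the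
recorded image type; vacuous for `none`. [cite: Zywina2015, Thm. 1.2 (ii), Thm. 1.4 (ii), Thm. 1.5 (ii)] -/
def passImage : Bool :=
  match r.imageCert with
  | none => true
  | some (u, v) =>
    decide (v ≠ 0) && decide (jMapDen r.imageType u v ≠ 0) &&
      decide ((c4Of r.ainvs) ^ 3 * jMapDen r.imageType u v = discOf r.ainvs * jMapNum r.imageType u v)

/-- The leaf's side clauses and the BSD invariants: `rank ≤ 1`, `rootNumber = (−1)^rank`,
`0 < shaAn`, `0 < torsion`; rank `0`: `x0 = (num, den)` with `den > 0` and
`num · torsion² = shaAn · tamagawa · den` (`L(E,1)/Ω_E = #Ш_an ∏c_q / #E(ℚ)²_tors`); rank `1`: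
`x0 = (0, 1)`; leaf X9 (`p ≥ 5`): `rank = 1 → ¬semistable`; leaf X10b (`p = 3`):
`(rank = 0 ∧ ¬ram(3)) ∨ (rank = 1 ∧ ¬semistable)`. [folklore] -/
def passInvariants : Bool :=
  decide (r.rank ≤ 1) && (r.rootNumber == (if r.rank == 0 then 1 else -1)) && decide (0 < r.shaAn) &&
  decide (0 < r.torsion) &&
  (if r.rank == 0 then
    decide (0 < r.x0.2) && decide (r.x0.1 * (r.torsion : ℤ) ^ 2 = (r.shaAn : ℤ) * r.tamagawa * r.x0.2)
   else (r.x0.1 == 0) && (r.x0.2 == 1)) &&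
  (if r.p == 3 then ((r.rank == 0) && !r.ram) || ((r.rank == 1) && !r.semistable)
   else decide (5 ≤ r.p) && ((r.rank == 0) || !r.semistable))

/-- The two-engine Iwasawa certificate, coherence only: `muAn = 0`; `lambdaAn ≡ rank (mod 2)`; rank
`0`: `lambdaAn = 0 ↔ (p ∤ num(x0) · den(x0) ∧ a_p ≢ 1 (mod p))` (constant term
`(1 − α⁻¹)² · L(E,1)/Ω_E` up to a `p`-adic unit); rank `1`: `1 ≤ lambdaAn`; at least one engine named.
[cite: MazurTateTeitelbaum1986Invent, §I.14 (interpolation property at the trivial character)] -/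
def passIwasawa : Bool :=
  (r.muAn == 0) && (r.lambdaAn % 2 == r.rank % 2) && decide (1 ≤ r.lpLevel) && !r.engines.isEmpty &&
  (if r.rank == 0 then
    (r.lambdaAn == 0) ==
      (decide (r.x0.1 % (r.p : ℤ) ≠ 0) && decide (r.x0.2 % r.p ≠ 0) && !r.anomalous)
   else decide (1 ≤ r.lambdaAn))

/-- Optional rank-`1` data: every Heegner triple `(D, m, v)` has `D < 0`, `D ≡ 0, 1 (mod 4)`, the
Heegner hypothesis at every bad prime (`q` odd: `(D|q) = +1`; `q = 2`: `D ≡ 1 (mod 8)`), `p ∤ D`,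
`0 < m` and `v = v_p(m)`; `schneider = some (v, d)` has `d ≥ 1`; both empty unless `rank = 1`.
[cite: GrossZagier1986, §I.1 (Heegner hypothesis)] -/
def passRankOne : Bool :=
  ((r.rank == 1) || (r.heegner.isEmpty && r.schneider.isNone)) &&
  r.heegner.all (fun h => decide (h.1 < 0) && decide (h.1 % 4 = 0 ∨ h.1 % 4 = 1) &&
    decide (h.1 % (r.p : ℤ) ≠ 0) && decide (0 < h.2.1) && (natVal r.p h.2.1 == h.2.2) &&
    r.bad.all (fun t => if t.1 == 2 then decide (h.1 % 8 = 1)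
      else decide (h.1 % (t.1 : ℤ) ≠ 0) && (legendreSym h.1 t.1 == 1))) &&
  (match r.schneider with | none => true | some (_, d) => decide (1 ≤ d))

/-- The full recheck of a record (conjunction of the eight checks above). [folklore] -/
def check : Bool :=
  r.passSupport && r.passReduction && r.passIrr && r.passNonCM && r.passImage &&
    r.passInvariants && r.passIwasawa && r.passRankOne

end Record

/-- A list of records is `Certified` when every one passes `Record.check`; this is the statement of each
generated theorem `theorem certified… : Certified [ … ] := by decide` of the files `X9/PrintCertRecords*.lean`. [folklore] -/
def Certified (rs : List Record) : Prop := rs.all Record.check = true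

/-- `Certified rs` is decidable (a `Bool` equation). [folklore] -/
instance Certified.instDecidable (rs : List Record) : Decidable (Certified rs) :=
  inferInstanceAs (Decidable (rs.all Record.check = true))

/-- Unpacking `Certified`: every listed record passes the recheck. [folklore] -/
theorem Certified.check_of_mem {rs : List Record} (h : Certified rs) {r : Record} (hr : r ∈ rs) :
    r.check = true :=
  List.all_eq_true.1 h r hr

namespace Record

variable (r : Record)
/-- Projection of a passing recheck: the support check holds. [folklore] -/
theorem passSupport_of_check (h : r.check = true) : r.passSupport = true := by
  simp only [check, Bool.and_eq_true] at h; exact h.1.1.1.1.1.1.1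
/-- Projection of a passing recheck: the reduction check holds. [folklore] -/
theorem passReduction_of_check (h : r.check = true) : r.passReduction = true := by
  simp only [check, Bool.and_eq_true] at h; exact h.1.1.1.1.1.1.2
/-- Projection of a passing recheck: the irreducibility-witness check holds. [folklore] -/
theorem passIrr_of_check (h : r.check = true) : r.passIrr = true := by
  simp only [check, Bool.and_eq_true] at h; exact h.1.1.1.1.1.2
/-- Projection of a passing recheck: the non-CM check holds. [folklore] -/
theorem passNonCM_of_check (h : r.check = true) : r.passNonCM = true := by
  simp only [check, Bool.and_eq_true] at h; exact h.1.1.1.1.2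
/-- Projection of a passing recheck: the image-certificate check holds. [folklore] -/
theorem passImage_of_check (h : r.check = true) : r.passImage = true := by
  simp only [check, Bool.and_eq_true] at h; exact h.1.1.1.2
/-- Projection of a passing recheck: the invariants check holds. [folklore] -/
theorem passInvariants_of_check (h : r.check = true) : r.passInvariants = true := by
  simp only [check, Bool.and_eq_true] at h; exact h.1.1.2
/-- Projection of a passing recheck: the Iwasawa-certificate coherence check holds. [folklore] -/
theorem passIwasawa_of_check (h : r.check = true) : r.passIwasawa = true := by
  simp only [check, Bool.and_eq_true] at h; exact h.1.2

/-- A passing record has `p = imageType.prime`, hence `p ∈ {3, 5, 7}`. [folklore] -/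
theorem p_eq_prime_of_check (h : r.check = true) : r.p = r.imageType.prime := by
  have h' := r.passReduction_of_check h
  simp only [passReduction, Bool.and_eq_true, beq_iff_eq] at h'
  exact h'.1.1.1.1.1

/-- A passing record has `p = 3 ∨ p = 5 ∨ p = 7`. [folklore] -/
theorem p_mem_of_check (h : r.check = true) : r.p = 3 ∨ r.p = 5 ∨ r.p = 7 := by
  rw [r.p_eq_prime_of_check h]
  cases r.imageType <;> simp [ImageType.prime]

/-- A passing record has `rank ≤ 1`, `0 < shaAn`, `muAn = 0`. [folklore] -/
theorem rank_le_one_shaAn_pos_of_check (h : r.check = true) : r.rank ≤ 1 ∧ 0 < r.shaAn ∧ r.muAn = 0 := by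
  have h1 := r.passInvariants_of_check h
  have h2 := r.passIwasawa_of_check h
  simp only [passInvariants, Bool.and_eq_true, decide_eq_true_eq] at h1
  simp only [passIwasawa, Bool.and_eq_true, beq_iff_eq] at h2
  exact ⟨h1.1.1.1.1.1, h1.1.1.1.2, h2.1.1.1.1⟩

/-- A passing record with an image certificate satisfies the exact `j`-identity
`c₄³ · B(u,v) = Δ · A(u,v)` with `B(u,v) ≠ 0`. [cite: Zywina2015, Thm. 1.4 (ii)] -/
theorem jIdentity_of_check (h : r.check = true) {u v : ℤ} (huv : r.imageCert = some (u, v)) :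
    jMapDen r.imageType u v ≠ 0 ∧
      (c4Of r.ainvs) ^ 3 * jMapDen r.imageType u v = discOf r.ainvs * jMapNum r.imageType u v := by
  have h' := r.passImage_of_check h
  simp only [passImage, huv, Bool.and_eq_true, decide_eq_true_eq] at h'
  exact ⟨h'.1.2, h'.2⟩

end Record

-- `decide` unfolds trial division (`List.range 710`) and point counting: raise the recursion depth.
set_option maxRecDepth 100000

/-- SAMPLE (and regression test of the recheck): the record of `2268b1 @ 5` — the census's smallest X9
pair of conductor `< 10⁴` (`N = 2268 = 2²·3⁴·7`, Cremona model `[0, 0, 0, -1161, 16389]`, image `5S4`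
with the certificate `t = -43/7` on Zywina's `J₉`: `j = t³(t² + 5t + 40) = -183184128/7⁵ = c₄³/Δ`,
`Δ = -2⁴·3¹⁰·7⁵`, multiplicative at `7` (`I₅`, `c₇ = 1`), additive at `2`, `3`;
`a₅ = -2` so `#Ẽ(𝔽₅) = 8`, ordinary, non-anomalous; irreducibility witness `ℓ = 11`, `a₁₁ = -1`
(`X² + X + 11 ≡ X² + X + 1` root-free mod `5`); rank `0`, `#Ш_an = 1`, `∏c_q = 1`, `#E(ℚ)_tors = 1`, so
`L(E,1)/Ω_E = 1`; engines B/C of `b2b-bsdres-x9` gen 9: `μ = 0`, `λ = 0` at level `2`) passes. [folklore] -/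
theorem certified_sample : Certified [
  { label := "2268b1", ainvs := [0, 0, 0, -1161, 16389], conductor := 2268, p := 5, imageType := .s4,
    image := "5S4", galrep := ["5S4"], imageCert := some (-43, 7),
    bad := [(2, 2, 4, 1), (3, 4, 10, 1), (7, 1, 5, 1)], kodaira := ["IV", "IV*", "I5"], ap := -2, nP := 8,
    irrWitness := (11, -1), isogDegrees := [1], rank := 0, rootNumber := 1, torsion := 1, tamagawa := 1,
    shaAn := 1, x0 := (1, 1), muAn := 0, lambdaAn := 0, lpLevel := 2, heegner := [], schneider := none,
    partners := [], engines := ["B:x9-g9 j079989", "C:x9-g9 j079996"], notes := "sample" } ] := by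
  decide

/-- Tampering is caught: the same record with `lambdaAn := 2` fails (rank `0`, `x0 = 1` a `5`-unit and
`a₅ = -2` non-anomalous force `λ_an = 0`). [folklore] -/
theorem not_certified_tampered : ¬ Certified [
  { label := "2268b1", ainvs := [0, 0, 0, -1161, 16389], conductor := 2268, p := 5, imageType := .s4,
    image := "5S4", galrep := ["5S4"], imageCert := some (-43, 7),
    bad := [(2, 2, 4, 1), (3, 4, 10, 1), (7, 1, 5, 1)], kodaira := ["IV", "IV*", "I5"], ap := -2, nP := 8,
    irrWitness := (11, -1), isogDegrees := [1], rank := 0, rootNumber := 1, torsion := 1, tamagawa := 1,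
    shaAn := 1, x0 := (1, 1), muAn := 0, lambdaAn := 2, lpLevel := 2, heegner := [], schneider := none,
    partners := [], engines := ["B:x9-g9 j079989", "C:x9-g9 j079996"], notes := "tampered" } ] := by
  decide

end Summit.BirchSwinnertonDyer.Rank1Residual.X9.PrintCert
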